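import Mathlib
import Summits.MatrixMultiplication.MatrixMultiplication.Theorems.SnSubsetDichotomyHyperoctahedralThresholdStubGoodTwin
import Summits.MatrixMultiplication.MatrixMultiplication.Theorems.SnSubsetDichotomyHyperoctahedralThresholdStubPatternTwin

/-!
# Same-colour reflection structures have no tips
(crux `SnSubsetDichotomy.HyperoctahedralThreshold`, stmt-MatrixMultiplication-10883, line `refutation-local-symmetry`;
`--supports` helpers for the open stub `stub_poorRigidCore`; crux NOTES §15.1, the TIP half of the supply/tip dichotomy)

Vocabulary of the line: `μ 0, μ 1, μ 2` are involutions of `Fin n` (the three perfect matchings); a colour word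
`w : List (Fin 3)` acts on the right, `x · w := w.foldl (fun v d => μ d v) x`.

A **same-colour (reflection) structure** of colour `c` and length `m` is a pair `(a, w)`, `|w| = m`, with
`List.IsChain (· ≠ ·) (c :: (w ++ [c]))` (`w` is reduced and neither begins nor ends with `c`) and
`(μ c a) · w = μ c (a · w)` (the word `w` carries the `c`-edge `{a, μ c a}` onto the `c`-edge at `a · w`,
side-preservingly).  Equivalently `a` — and then also `μ c a` — is a fixed point of the cyclically reduced word
`z = c w c w⁻¹` of length `2m + 2` (`structure_fixed`, `structure_isChain`), so the poorness / rigidity hypotheses of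
the stub speak about these structures.  The rungs of the structure are `S_i := {a · w.take i, (μ c a) · w.take i}`,
`i = 0 … m`; `S_0` and `S_m` are edges of the matching `M_c`, and the trajectory of the pair `(a, μ c a)` along `z`
visits exactly the rungs `S_0, S_0, S_1, …, S_m, S_m, …, S_1` (`structure_traj`).

Main statement (`structure_cleanWalk`): two edges of one perfect matching are equal or disjoint (`matching_eod`), so
the END rungs `S_0, S_m` never form a defect ("no tips": the term of the same order as the supply in the mixed-colour
count of NOTES §9 (D2) is absent), and a structure all of whose OTHER rung pairs are equal-or-disjoint and whose points
avoid `R` is — verbatim — closed-colour-walk data in the format of the conclusion of `stub_poorRigidCore` /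
`stub_cleanWalk`, with `k + 1 = 2m + 2` rungs.  The packaging goes through the general lemma `twin_cleanWalk`: two
distinct fixed points of a cyclically reduced word whose rung SETS are pairwise equal-or-disjoint give such data
(steps side-preserving by `GoodTwin.foldl_take_step`, colours by `GoodTwin.cyclic_ne`).

Pure finite combinatorics; hypotheses only `μ d * μ d = 1` and `μ c a ≠ a`.  No definitions are introduced.
The SUPPLY half of the dichotomy (NOTES (15.1)) is the companion file `…SameColourSupply`.
-/

set_option linter.dupNamespace false

namespace Summit.MatrixMultiplication.MatrixMultiplication.Theorems.HyperoctahedralThreshold.SameColourTip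

open GoodTwin

variable {n : ℕ}

/-- An involution undoes itself pointwise. -/
theorem act_invol (μ : Fin 3 → Equiv.Perm (Fin n)) (hμ : ∀ d, μ d * μ d = 1) (c : Fin 3) (x : Fin n) :
    μ c (μ c x) = x := by
  have : (μ c * μ c) x = x := by rw [hμ c]; rfl
  simpa using this

/-- Walking back along the reversed word undoes the walk (letters are involutions). [folklore] -/
theorem foldl_act_reverse (μ : Fin 3 → Equiv.Perm (Fin n)) (hμ : ∀ d, μ d * μ d = 1) :
    ∀ (w : List (Fin 3)) (x : Fin n),
      w.reverse.foldl (fun v d => μ d v) (w.foldl (fun v d => μ d v) x) = x := by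
  intro w
  induction w with
  | nil => intro x; rfl
  | cons c w ih =>
    intro x
    rw [List.foldl_cons, List.reverse_cons, List.foldl_append, ih]
    exact act_invol μ hμ c x

/-- **Structures are fixed points.**  If `w` carries the `c`-edge at `a` onto the `c`-edge at `a · w`
side-preservingly, then both `a` and `μ c a` are fixed by the word `c w c w⁻¹`. [this line, NOTES §15.1] -/
theorem structure_fixed (μ : Fin 3 → Equiv.Perm (Fin n)) (hμ : ∀ d, μ d * μ d = 1) (c : Fin 3)
    (a : Fin n) (w : List (Fin 3))
    (hw : w.foldl (fun v d => μ d v) (μ c a) = μ c (w.foldl (fun v d => μ d v) a)) :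
    (c :: (w ++ c :: w.reverse)).foldl (fun v d => μ d v) a = a ∧
      (c :: (w ++ c :: w.reverse)).foldl (fun v d => μ d v) (μ c a) = μ c a := by
  constructor
  · simp only [List.foldl_cons, List.foldl_append]
    rw [hw, act_invol μ hμ, foldl_act_reverse μ hμ]
  · simp only [List.foldl_cons, List.foldl_append]
    rw [act_invol μ hμ, ← hw, foldl_act_reverse μ hμ]

/-- The word of a same-colour structure is nonempty. -/
theorem ne_nil_of_isChain {c : Fin 3} {w : List (Fin 3)} (h : List.IsChain (· ≠ ·) (c :: (w ++ [c]))) :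
    w ≠ [] := by
  rintro rfl
  simp at h

/-- The last letter of the word of a same-colour structure is not the loop colour. -/
theorem getLast_ne {c : Fin 3} {w : List (Fin 3)} (h : List.IsChain (· ≠ ·) (c :: (w ++ [c]))) :
    ∀ y ∈ w.getLast?, y ≠ c := by
  intro y hy
  have hsplit := List.dropLast_append_getLast? y hy
  rw [← hsplit] at h
  have h' : List.IsChain (· ≠ ·) (c :: (w.dropLast ++ y :: c :: [])) := by
    simpa [List.append_assoc] using h
  exact (List.isChain_cons_append_cons_cons.1 h').2.1

/-- **Structure words are cyclically reduced**: if `c w c` is reduced then `z := c w c w⁻¹` satisfies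
`IsChain (· ≠ ·) (z ++ z)`. [this line] -/
theorem structure_isChain {c : Fin 3} {w : List (Fin 3)} (h : List.IsChain (· ≠ ·) (c :: (w ++ [c]))) :
    List.IsChain (· ≠ ·) ((c :: (w ++ c :: w.reverse)) ++ (c :: (w ++ c :: w.reverse))) := by
  have hw0 : w ≠ [] := ne_nil_of_isChain h
  have hw : List.IsChain (· ≠ ·) w := h.tail.left_of_append
  have hwr : List.IsChain (· ≠ ·) w.reverse :=
    List.isChain_reverse.2 (hw.imp fun a b (hab : a ≠ b) => hab.symm)
  have hlast := getLast_ne h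
  have hz : List.IsChain (· ≠ ·) (c :: (w ++ c :: w.reverse)) := by
    refine List.isChain_cons_split.2 ⟨h, List.isChain_cons.2 ⟨?_, hwr⟩⟩
    intro y hy
    rw [List.head?_reverse] at hy
    exact (hlast y hy).symm
  obtain ⟨b, v, rfl⟩ := List.exists_cons_of_ne_nil hw0
  have hcb : c ≠ b := (List.isChain_cons_cons.1 h).1
  refine List.isChain_append.2 ⟨hz, hz, ?_⟩
  intro x hx y hy
  have e : (c :: (b :: v ++ c :: (b :: v).reverse)) = (c :: b :: v ++ c :: v.reverse) ++ [b] := by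
    simp [List.reverse_cons, List.append_assoc]
  rw [e, List.getLast?_concat] at hx
  have hx' : b = x := Option.mem_some_iff.1 hx
  have hy' : c = y := Option.mem_some_iff.1 (by simpa using hy)
  rw [← hx', ← hy']
  exact hcb.symm

/-- **No tips**: two edges `{x, μ c x}`, `{y, μ c y}` of the matching of an involution `μ c` are equal or
disjoint, in the "equal-or-disjoint rungs" format of the line. [this line, NOTES §15.1] -/
theorem matching_eod (μ : Fin 3 → Equiv.Perm (Fin n)) (hμ : ∀ d, μ d * μ d = 1) (c : Fin 3) (x y : Fin n) :
    (x = y ∧ μ c x = μ c y) ∨ (x = μ c y ∧ μ c x = y) ∨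
      (x ≠ y ∧ x ≠ μ c y ∧ μ c x ≠ y ∧ μ c x ≠ μ c y) := by
  by_cases hxy : x = y
  · exact Or.inl ⟨hxy, by rw [hxy]⟩
  by_cases hxy' : x = μ c y
  · exact Or.inr (Or.inl ⟨hxy', by rw [hxy', act_invol μ hμ]⟩)
  refine Or.inr (Or.inr ⟨hxy, hxy', ?_, ?_⟩)
  · intro h
    apply hxy'
    rw [← h, act_invol μ hμ]
  · intro h
    exact hxy ((μ c).injective h)

/-- Equal-or-disjointness of two rungs is invariant under swapping the sides of the first rung. -/
theorem eod_swap_left {p q p' q' : Fin n}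
    (h : (p = p' ∧ q = q') ∨ (p = q' ∧ q = p') ∨ (p ≠ p' ∧ p ≠ q' ∧ q ≠ p' ∧ q ≠ q')) :
    (q = p' ∧ p = q') ∨ (q = q' ∧ p = p') ∨ (q ≠ p' ∧ q ≠ q' ∧ p ≠ p' ∧ p ≠ q') := by
  rcases h with ⟨h1, h2⟩ | ⟨h1, h2⟩ | ⟨h1, h2, h3, h4⟩
  · exact Or.inr (Or.inl ⟨h2, h1⟩)
  · exact Or.inl ⟨h2, h1⟩
  · exact Or.inr (Or.inr ⟨h3, h4, h1, h2⟩)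

/-- Equal-or-disjointness of two rungs is invariant under swapping the sides of the second rung. -/
theorem eod_swap_right {p q p' q' : Fin n}
    (h : (p = p' ∧ q = q') ∨ (p = q' ∧ q = p') ∨ (p ≠ p' ∧ p ≠ q' ∧ q ≠ p' ∧ q ≠ q')) :
    (p = q' ∧ q = p') ∨ (p = p' ∧ q = q') ∨ (p ≠ q' ∧ p ≠ p' ∧ q ≠ q' ∧ q ≠ p') := by
  rcases h with ⟨h1, h2⟩ | ⟨h1, h2⟩ | ⟨h1, h2, h3, h4⟩
  · exact Or.inr (Or.inl ⟨h1, h2⟩)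
  · exact Or.inl ⟨h1, h2⟩
  · exact Or.inr (Or.inr ⟨h2, h1, h4, h3⟩)

/-- **Packaging a twin pre-pair.**  Two distinct fixed points `x, y` of a cyclically reduced word `z` whose rung
SETS `{x · z.take t, y · z.take t}` are pairwise equal-or-disjoint and avoid `R` give closed-colour-walk data in the
exact format of the conclusion of `stub_cleanWalk` / `stub_poorRigidCore`, with `k + 1 = |z|` rungs
(`p t := x · z.take t`, `q t := y · z.take t`, `col t := z[t]`; steps are side-preserving, `GoodTwin.foldl_take_step`;
colours by `GoodTwin.cyclic_ne`). [this line] -/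
theorem twin_cleanWalk (μ : Fin 3 → Equiv.Perm (Fin n)) (R : Finset (Fin n)) (z : List (Fin 3))
    (hz1 : z ≠ []) (hzc : List.IsChain (· ≠ ·) (z ++ z)) (x y : Fin n) (hxy : x ≠ y)
    (hx : z.foldl (fun v c => μ c v) x = x) (hy : z.foldl (fun v c => μ c v) y = y)
    (heod : ∀ s t : ℕ, s < z.length → t < z.length →
      ((z.take s).foldl (fun v c => μ c v) x = (z.take t).foldl (fun v c => μ c v) x ∧
          (z.take s).foldl (fun v c => μ c v) y = (z.take t).foldl (fun v c => μ c v) y) ∨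
        ((z.take s).foldl (fun v c => μ c v) x = (z.take t).foldl (fun v c => μ c v) y ∧
          (z.take s).foldl (fun v c => μ c v) y = (z.take t).foldl (fun v c => μ c v) x) ∨
        ((z.take s).foldl (fun v c => μ c v) x ≠ (z.take t).foldl (fun v c => μ c v) x ∧
          (z.take s).foldl (fun v c => μ c v) x ≠ (z.take t).foldl (fun v c => μ c v) y ∧
          (z.take s).foldl (fun v c => μ c v) y ≠ (z.take t).foldl (fun v c => μ c v) x ∧
          (z.take s).foldl (fun v c => μ c v) y ≠ (z.take t).foldl (fun v c => μ c v) y))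
    (hR : ∀ t < z.length,
      (z.take t).foldl (fun v c => μ c v) x ∉ R ∧ (z.take t).foldl (fun v c => μ c v) y ∉ R) :
    ∃ (k : ℕ) (p q : Fin (k + 1) → Fin n) (col : Fin (k + 1) → Fin 3), (∀ i, p i ≠ q i) ∧
      (∀ i, (μ (col i) (p i) = p (i + 1) ∧ μ (col i) (q i) = q (i + 1)) ∨
        (μ (col i) (p i) = q (i + 1) ∧ μ (col i) (q i) = p (i + 1))) ∧
      (∀ i, col i ≠ col (i + 1)) ∧
      (∀ i j, (p i = p j ∧ q i = q j) ∨ (p i = q j ∧ q i = p j) ∨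
        (p i ≠ p j ∧ p i ≠ q j ∧ q i ≠ p j ∧ q i ≠ q j)) ∧
      (∀ i, p i ∉ R ∧ q i ∉ R) ∧ k + 1 = z.length := by
  have hz0 : 0 < z.length := List.length_pos_of_ne_nil hz1
  obtain ⟨k, hk⟩ : ∃ k, k + 1 = z.length := ⟨z.length - 1, by omega⟩
  have hlt : ∀ i : Fin (k + 1), (i : ℕ) < z.length := fun i => i.isLt.trans_eq hk
  have hval : ∀ i : Fin (k + 1), ((i + 1 : Fin (k + 1)) : ℕ) = ((i : ℕ) + 1) % z.length :=
    fun i => by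
      rw [PatternTwin.val_add_one]
      exact congrArg (fun N => ((i : ℕ) + 1) % N) hk
  refine ⟨k, fun i => (z.take i).foldl (fun v c => μ c v) x, fun i => (z.take i).foldl (fun v c => μ c v) y,
    fun i => z[(i : ℕ)]'(hlt i), ?_, ?_, ?_, ?_, ?_, hk⟩
  · intro i h
    exact hxy (foldl_injective μ (z.take i) h)
  · intro i
    refine Or.inl ⟨?_, ?_⟩
    · show μ (z[(i : ℕ)]'(hlt i)) ((z.take i).foldl (fun v c => μ c v) x) =
        (z.take ((i + 1 : Fin (k + 1)) : ℕ)).foldl (fun v c => μ c v) x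
      rw [hval i]
      exact foldl_take_step μ z x hx i (hlt i)
    · show μ (z[(i : ℕ)]'(hlt i)) ((z.take i).foldl (fun v c => μ c v) y) =
        (z.take ((i + 1 : Fin (k + 1)) : ℕ)).foldl (fun v c => μ c v) y
      rw [hval i]
      exact foldl_take_step μ z y hy i (hlt i)
  · intro i
    exact cyclic_ne hzc i _ (hlt i) (hlt (i + 1)) (hval i)
  · intro i j
    exact heod i j (hlt i) (hlt j)
  · intro i
    exact hR i (hlt i)

/-- Walking `s ≤ |w|` steps back from `x · w` along `w⁻¹` lands at `x · w.take (|w| - s)`. -/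
theorem foldl_reverse_take (μ : Fin 3 → Equiv.Perm (Fin n)) (hμ : ∀ d, μ d * μ d = 1) (w : List (Fin 3))
    (s : ℕ) (x : Fin n) :
    (w.reverse.take s).foldl (fun v d => μ d v) (w.foldl (fun v d => μ d v) x) =
      (w.take (w.length - s)).foldl (fun v d => μ d v) x := by
  have e : w.foldl (fun v d => μ d v) x =
      (w.drop (w.length - s)).foldl (fun v d => μ d v) ((w.take (w.length - s)).foldl (fun v d => μ d v) x) := by
    rw [← List.foldl_append, List.take_append_drop]
  rw [List.take_reverse, e]
  exact foldl_act_reverse μ hμ _ _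

/-- **The trajectory of a same-colour structure** along `z = c w c w⁻¹` visits only its rungs
`S_i = {a · w.take i, (μ c a) · w.take i}` (`i ≤ |w|`), possibly with the two sides exchanged. -/
theorem structure_traj (μ : Fin 3 → Equiv.Perm (Fin n)) (hμ : ∀ d, μ d * μ d = 1) (c : Fin 3) (a : Fin n)
    (w : List (Fin 3)) (hcomm : w.foldl (fun v d => μ d v) (μ c a) = μ c (w.foldl (fun v d => μ d v) a))
    (t : ℕ) (ht : t < 2 * w.length + 2) :
    ∃ i ≤ w.length,
      (((c :: (w ++ c :: w.reverse)).take t).foldl (fun v d => μ d v) a = (w.take i).foldl (fun v d => μ d v) a ∧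
        ((c :: (w ++ c :: w.reverse)).take t).foldl (fun v d => μ d v) (μ c a) =
          (w.take i).foldl (fun v d => μ d v) (μ c a)) ∨
      (((c :: (w ++ c :: w.reverse)).take t).foldl (fun v d => μ d v) a =
          (w.take i).foldl (fun v d => μ d v) (μ c a) ∧
        ((c :: (w ++ c :: w.reverse)).take t).foldl (fun v d => μ d v) (μ c a) =
          (w.take i).foldl (fun v d => μ d v) a) := by
  rcases Nat.eq_zero_or_pos t with rfl | ht0
  · exact ⟨0, Nat.zero_le _, Or.inl ⟨by simp, by simp⟩⟩
  by_cases ht1 : t ≤ w.length + 1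
  · -- on the way out: `z.take t = c :: w.take (t - 1)`, sides exchanged
    refine ⟨t - 1, by omega, Or.inr ?_⟩
    have e : (c :: (w ++ c :: w.reverse)).take t = c :: w.take (t - 1) := by
      rw [show t = (t - 1) + 1 by omega, List.take_succ_cons, List.take_append_of_le_length (by omega)]
      simp
    rw [e, List.foldl_cons, List.foldl_cons, act_invol μ hμ]
    exact ⟨rfl, rfl⟩
  · -- on the way back: `z.take t = c :: (w ++ c :: w⁻¹.take s)` with `s = t - |w| - 2`
    set s : ℕ := t - (w.length + 2) with hs
    refine ⟨w.length - s, Nat.sub_le _ _, Or.inl ?_⟩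
    have e : (c :: (w ++ c :: w.reverse)).take t = c :: (w ++ c :: w.reverse.take s) := by
      rw [show t = (w.length + (s + 1)) + 1 by omega, List.take_succ_cons, List.take_length_add_append,
        List.take_succ_cons]
    rw [e]
    simp only [List.foldl_cons, List.foldl_append]
    rw [hcomm, act_invol μ hμ, act_invol μ hμ, ← hcomm]
    exact ⟨foldl_reverse_take μ hμ w s a, foldl_reverse_take μ hμ w s (μ c a)⟩

/-- **The tip half of the dichotomy** (crux NOTES §15.1).  A same-colour structure `(a, w)` of colour `c`
(`c w c` reduced, `(μ c a) · w = μ c (a · w)`, `μ c a ≠ a`) all of whose rung pairs `(S_i, S_j)` OTHER THAN THE TWO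
END RUNGS `(S_0, S_|w|)` are equal or disjoint, and whose points avoid `R`, is closed-colour-walk data in the exact
format of the conclusion of `stub_poorRigidCore` (`stub_cleanWalk`), with `k + 1 = 2|w| + 2` rungs: the end rungs are
two edges of the matching `M_c`, hence equal or disjoint for free (`matching_eod`). [this line] -/
theorem structure_cleanWalk (μ : Fin 3 → Equiv.Perm (Fin n)) (hμ : ∀ d, μ d * μ d = 1) (R : Finset (Fin n))
    (c : Fin 3) (a : Fin n) (w : List (Fin 3)) (ha : μ c a ≠ a)
    (hchain : List.IsChain (· ≠ ·) (c :: (w ++ [c])))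
    (hcomm : w.foldl (fun v d => μ d v) (μ c a) = μ c (w.foldl (fun v d => μ d v) a))
    (heod : ∀ i j : ℕ, i ≤ w.length → j ≤ w.length → ¬ (i = 0 ∧ j = w.length) → ¬ (i = w.length ∧ j = 0) →
      ((w.take i).foldl (fun v d => μ d v) a = (w.take j).foldl (fun v d => μ d v) a ∧
          (w.take i).foldl (fun v d => μ d v) (μ c a) = (w.take j).foldl (fun v d => μ d v) (μ c a)) ∨
        ((w.take i).foldl (fun v d => μ d v) a = (w.take j).foldl (fun v d => μ d v) (μ c a) ∧
          (w.take i).foldl (fun v d => μ d v) (μ c a) = (w.take j).foldl (fun v d => μ d v) a) ∨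
        ((w.take i).foldl (fun v d => μ d v) a ≠ (w.take j).foldl (fun v d => μ d v) a ∧
          (w.take i).foldl (fun v d => μ d v) a ≠ (w.take j).foldl (fun v d => μ d v) (μ c a) ∧
          (w.take i).foldl (fun v d => μ d v) (μ c a) ≠ (w.take j).foldl (fun v d => μ d v) a ∧
          (w.take i).foldl (fun v d => μ d v) (μ c a) ≠ (w.take j).foldl (fun v d => μ d v) (μ c a)))
    (hR : ∀ i ≤ w.length,
      (w.take i).foldl (fun v d => μ d v) a ∉ R ∧ (w.take i).foldl (fun v d => μ d v) (μ c a) ∉ R) :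
    ∃ (k : ℕ) (p q : Fin (k + 1) → Fin n) (col : Fin (k + 1) → Fin 3), (∀ i, p i ≠ q i) ∧
      (∀ i, (μ (col i) (p i) = p (i + 1) ∧ μ (col i) (q i) = q (i + 1)) ∨
        (μ (col i) (p i) = q (i + 1) ∧ μ (col i) (q i) = p (i + 1))) ∧
      (∀ i, col i ≠ col (i + 1)) ∧
      (∀ i j, (p i = p j ∧ q i = q j) ∨ (p i = q j ∧ q i = p j) ∨
        (p i ≠ p j ∧ p i ≠ q j ∧ q i ≠ p j ∧ q i ≠ q j)) ∧
      (∀ i, p i ∉ R ∧ q i ∉ R) ∧ k + 1 = 2 * w.length + 2 := by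
  have hzlen : (c :: (w ++ c :: w.reverse)).length = 2 * w.length + 2 := by
    simp only [List.length_cons, List.length_append, List.length_reverse]
    ring
  obtain ⟨hfa, hfb⟩ := structure_fixed μ hμ c a w hcomm
  have hzc := structure_isChain hchain
  -- equal-or-disjointness of ALL rung pairs: the end pair is free
  have hall : ∀ i j : ℕ, i ≤ w.length → j ≤ w.length →
      ((w.take i).foldl (fun v d => μ d v) a = (w.take j).foldl (fun v d => μ d v) a ∧
          (w.take i).foldl (fun v d => μ d v) (μ c a) = (w.take j).foldl (fun v d => μ d v) (μ c a)) ∨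
        ((w.take i).foldl (fun v d => μ d v) a = (w.take j).foldl (fun v d => μ d v) (μ c a) ∧
          (w.take i).foldl (fun v d => μ d v) (μ c a) = (w.take j).foldl (fun v d => μ d v) a) ∨
        ((w.take i).foldl (fun v d => μ d v) a ≠ (w.take j).foldl (fun v d => μ d v) a ∧
          (w.take i).foldl (fun v d => μ d v) a ≠ (w.take j).foldl (fun v d => μ d v) (μ c a) ∧
          (w.take i).foldl (fun v d => μ d v) (μ c a) ≠ (w.take j).foldl (fun v d => μ d v) a ∧
          (w.take i).foldl (fun v d => μ d v) (μ c a) ≠ (w.take j).foldl (fun v d => μ d v) (μ c a)) := by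
    intro i j hi hj
    by_cases h1 : i = 0 ∧ j = w.length
    · obtain ⟨rfl, rfl⟩ := h1
      rw [List.take_zero, List.foldl_nil, List.foldl_nil, List.take_length, hcomm]
      exact matching_eod μ hμ c a _
    by_cases h2 : i = w.length ∧ j = 0
    · obtain ⟨rfl, rfl⟩ := h2
      rw [List.take_zero, List.foldl_nil, List.foldl_nil, List.take_length, hcomm]
      exact matching_eod μ hμ c (w.foldl (fun v d => μ d v) a) a
    exact heod i j hi hj h1 h2
  -- transported to the trajectory positions of `z = c w c w⁻¹`
  have heodz : ∀ s t : ℕ, s < (c :: (w ++ c :: w.reverse)).length → t < (c :: (w ++ c :: w.reverse)).length →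
      ((((c :: (w ++ c :: w.reverse))).take s).foldl (fun v d => μ d v) a =
            (((c :: (w ++ c :: w.reverse))).take t).foldl (fun v d => μ d v) a ∧
          (((c :: (w ++ c :: w.reverse))).take s).foldl (fun v d => μ d v) (μ c a) =
            (((c :: (w ++ c :: w.reverse))).take t).foldl (fun v d => μ d v) (μ c a)) ∨
        ((((c :: (w ++ c :: w.reverse))).take s).foldl (fun v d => μ d v) a =
            (((c :: (w ++ c :: w.reverse))).take t).foldl (fun v d => μ d v) (μ c a) ∧
          (((c :: (w ++ c :: w.reverse))).take s).foldl (fun v d => μ d v) (μ c a) =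
            (((c :: (w ++ c :: w.reverse))).take t).foldl (fun v d => μ d v) a) ∨
        ((((c :: (w ++ c :: w.reverse))).take s).foldl (fun v d => μ d v) a ≠
            (((c :: (w ++ c :: w.reverse))).take t).foldl (fun v d => μ d v) a ∧
          (((c :: (w ++ c :: w.reverse))).take s).foldl (fun v d => μ d v) a ≠
            (((c :: (w ++ c :: w.reverse))).take t).foldl (fun v d => μ d v) (μ c a) ∧
          (((c :: (w ++ c :: w.reverse))).take s).foldl (fun v d => μ d v) (μ c a) ≠
            (((c :: (w ++ c :: w.reverse))).take t).foldl (fun v d => μ d v) a ∧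
          (((c :: (w ++ c :: w.reverse))).take s).foldl (fun v d => μ d v) (μ c a) ≠
            (((c :: (w ++ c :: w.reverse))).take t).foldl (fun v d => μ d v) (μ c a)) := by
    intro s t hs ht
    rw [hzlen] at hs ht
    obtain ⟨i, hi, hci⟩ := structure_traj μ hμ c a w hcomm s hs
    obtain ⟨j, hj, hcj⟩ := structure_traj μ hμ c a w hcomm t ht
    have hij := hall i j hi hj
    rcases hci with ⟨e1, e2⟩ | ⟨e1, e2⟩
    · rcases hcj with ⟨e3, e4⟩ | ⟨e3, e4⟩
      · rw [e1, e2, e3, e4]; exact hij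
      · rw [e1, e2, e3, e4]; exact eod_swap_right hij
    · rcases hcj with ⟨e3, e4⟩ | ⟨e3, e4⟩
      · rw [e1, e2, e3, e4]; exact eod_swap_left hij
      · rw [e1, e2, e3, e4]; exact eod_swap_left (eod_swap_right hij)
  have hRz : ∀ t < (c :: (w ++ c :: w.reverse)).length,
      (((c :: (w ++ c :: w.reverse))).take t).foldl (fun v d => μ d v) a ∉ R ∧
        (((c :: (w ++ c :: w.reverse))).take t).foldl (fun v d => μ d v) (μ c a) ∉ R := by
    intro t ht
    rw [hzlen] at ht
    obtain ⟨i, hi, hci⟩ := structure_traj μ hμ c a w hcomm t ht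
    rcases hci with ⟨e1, e2⟩ | ⟨e1, e2⟩
    · rw [e1, e2]; exact hR i hi
    · rw [e1, e2]; exact (hR i hi).symm
  obtain ⟨k, p, q, col, h1, h2, h3, h4, h5, hk⟩ := twin_cleanWalk μ R (c :: (w ++ c :: w.reverse))
    (List.cons_ne_nil _ _) hzc a (μ c a) (fun h => ha h.symm) hfa hfb heodz hRz
  exact ⟨k, p, q, col, h1, h2, h3, h4, h5, by omega⟩

/-- **Registered form** (`stub_sameColourNoTips`, a `--supports` sub-goal of crux `stmt-MatrixMultiplication-10883`):
the tip half of the supply/tip dichotomy, `structure_cleanWalk` fully quantified. -/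
theorem stub_sameColourNoTips : ∀ (n : ℕ) (μ : Fin 3 → Equiv.Perm (Fin n)) (R : Finset (Fin n)) (c : Fin 3) (a : Fin n) (w : List (Fin 3)), (∀ d, μ d * μ d = 1) → μ c a ≠ a → List.IsChain (· ≠ ·) (c :: (w ++ [c])) → w.foldl (fun v d => μ d v) (μ c a) = μ c (w.foldl (fun v d => μ d v) a) → (∀ i j : ℕ, i ≤ w.length → j ≤ w.length → ¬ (i = 0 ∧ j = w.length) → ¬ (i = w.length ∧ j = 0) → ((w.take i).foldl (fun v d => μ d v) a = (w.take j).foldl (fun v d => μ d v) a ∧ (w.take i).foldl (fun v d => μ d v) (μ c a) = (w.take j).foldl (fun v d => μ d v) (μ c a)) ∨ ((w.take i).foldl (fun v d => μ d v) a = (w.take j).foldl (fun v d => μ d v) (μ c a) ∧ (w.take i).foldl (fun v d => μ d v) (μ c a) = (w.take j).foldl (fun v d => μ d v) a) ∨ ((w.take i).foldl (fun v d => μ d v) a ≠ (w.take j).foldl (fun v d => μ d v) a ∧ (w.take i).foldl (fun v d => μ d v) a ≠ (w.take j).foldl (fun v d => μ d v) (μ c a) ∧ (w.take i).foldl (fun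 v d => μ d v) (μ c a) ≠ (w.take j).foldl (fun v d => μ d v) a ∧ (w.take i).foldl (fun v d => μ d v) (μ c a) ≠ (w.take j).foldl (fun v d => μ d v) (μ c a))) → (∀ i ≤ w.length, (w.take i).foldl (fun v d => μ d v) a ∉ R ∧ (w.take i).foldl (fun v d => μ d v) (μ c a) ∉ R) → ∃ (k : ℕ) (p q : Fin (k + 1) → Fin n) (col : Fin (k + 1) → Fin 3), (∀ i, p i ≠ q i) ∧ (∀ i, (μ (col i) (p i) = p (i + 1) ∧ μ (col i) (q i) = q (i + 1)) ∨ (μ (col i) (p i) = q (i + 1) ∧ μ (col i) (q i) = p (i + 1))) ∧ (∀ i, col i ≠ col (i + 1)) ∧ (∀ i j, (p i = p j ∧ q i = q j) ∨ (p i = q j ∧ q i = p j) ∨ (p i ≠ p j ∧ p i ≠ q j ∧ q i ≠ p j ∧ q i ≠ q j)) ∧ (∀ i, p i ∉ R ∧ q i ∉ R) ∧ k + 1 = 2 * w.length + 2 :=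
  fun _ μ R c a w hμ ha hchain hcomm heod hR => structure_cleanWalk μ hμ R c a w ha hchain hcomm heod hR

end Summit.MatrixMultiplication.MatrixMultiplication.Theorems.HyperoctahedralThreshold.SameColourTip
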